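import Literature.NumberTheory.Automorphic.DiscreteAutomorphicRepNormalFixedVectors     -- ★ `rightRegular_toLp_toQuotFun_eq_self_of_mul_right` (the class of a right-`K`-invariant form is `R(K)`-fixed); brings ★ `toQuotFun`
import Literature.NumberTheory.Automorphic.UnitaryGroupAdelicProduct                      -- ★ `finAdelic`, `finAdelicToAdelic`, `continuous_finAdelicToAdelic`
import Literature.NumberTheory.Automorphic.IntegratedOperatorStar                         -- ★ `ContRepresentation.restrict`, `IsUnitary.restrict`, `IsStronglyContinuous.restrict`; brings ★ `integratedOperator`, `integratedOperator_apply`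
import Literature.NumberTheory.Automorphic.AutomorphicForms                               -- ★ `rightTranslation`
import HarnessLib

/-!
# R90-TF · S8 «ContSpec-n½» — `R90S8PseudoEisensteinHeckePortL2U3`: THE `L²` ∕ `integratedOperator` PORT OF A HECKE OPERATOR
# «`T_v [θ] = vol(K_v) · [Σ_i c_i θ(· k_i)]` for right-`K_v`-invariant `θ`» (brick PB-3a-port of the E1-Plancherel body)

Cell `hodgecm-mathlib`, crux H413 (`stmt-HodgeConjecture-24833`, lane `--supports … --as helper`), route of record `HCCMUnconditional`; R90-TF section S8, socket (E)
`sock_S8_res_exhaustion_le_closure` (B ED. 7 :276), (N₃) row per `K_∞`-type, whose bill carries (L1) the commuting family `T j ∈ {R_∞(a) ∘ R_f(b)}` (★ `R90S8ResGIsotypicTauLinesU3`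
:156–:159) and K2E1-p16's line-model letter `hTx : ∀ j i, T j (x i) = x (σ j i)` (★ p865235 `exists_lineModelLetters_of_gram_proj` :238).  Prover seat LH7-p07 (g3), S8 dealer
R90-CS-plan (g4) S8-R272 (1) (2026-09-05T03:54Z): «PB-3a-port — the `L²`∕`integratedOperator` port `T_v (toLp θ_{f,ψ}) = toLp (Σ_i c_i • θ_{f,ψ}(· k_i))` in (L1) currency, generator-level, so
that `hTx` reads ★ F0P2-p11 p865246 `sum_smul_rightTranslation_pseudoEisenstein_eq_of_localLetter` (FUNCTION-level: `Σ_{i∈s} c i • rightTranslation 𝒢 (k i) θ_{f,ψ} = θ_{fd,ψ}`)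
THROUGH this port».  THEOREMS ONLY (no `def`, no `instance`, no `notation`, no named-fact hypothesis, no `sorry`; default heartbeats); the unramified local Satake letter `hloc`
of PB-3a is NOT in this file (it stays PB-3a's hypothesis).

THE MATHEMATICS ([BorelJacquet1979] §4.6; [Cartier1979] §IV.1 (the Hecke algebra `H(G_v, K_v)` acting by `π(𝟙_{K a K}) = vol(K)·Σ_{aK ⊂ KaK} π(a)` on `K`-fixed vectors);
[Folland1995] §3.2).  §1 (GENERIC, any continuous unitary representation `π` of a topological group `G` on a Hilbert space, `η` left-invariant and finite on compacts,
`K ≤ G` compact open, `v` a `K`-FIXED vector, `b = Σ_{i∈s} c_i·𝟙_{a_i K} ∈ C_c(G)`): **`π(b) v = η(K) · Σ_i c_i π(a_i) v`** — `∫ b(y) π(y) v dη = Σ_i c_i ∫_{a_i K} π(y) v`, and on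
the coset `y = a_i k`, `π(y) v = π(a_i) π(k) v = π(a_i) v`, while `η(a_i K) = η(K)` (left invariance).  §2 (AUTOMORPHIC READING, `𝒢 = adelicGroupData F E c N J`, `R` the right
regular representation on `L²([G])`, classes `[Φ] := toLp (toQuotFun 𝒢 Φ)` of left-`A_G G(K)`-invariant `Φ : G(𝔸) → ℂ`, ★ `toQuotFun`): the class of a translate is the
translate of the class a.e. — `R(k)[Φ] =ᵐ toQuotFun (rightTranslation 𝒢 k Φ)` (★ `rightRegular_apply_coeFn`: `(R(k)[Φ])(q) = [Φ](k⁻¹ q) = Φ(x⁻¹ k)` at `q = [x]`) — so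
finite sums of translates of the class are the class of the finite sum of translates (`Lp.ext` on a.e. representatives); with §1 at `π := R|_{G(𝔸_f)}` (★ `finAdelicToAdelic`),
`K ≤ G(𝔸_f)` compact open, `[Φ]` `K`-fixed because `Φ` is right-`K`-invariant (★ `rightRegular_toLp_toQuotFun_eq_self_of_mul_right`):
**`R_f(b) [Φ] = ν_f(K) · [Φ′]`** whenever `Σ_{i∈s} c_i • rightTranslation 𝒢 (ι a_i) Φ = Φ′` as functions — EXACTLY the shape PB-3a delivers (`Φ := θ_{f,ψ}`, `Φ′ := θ_{fd,ψ}`),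
i.e. `hTx` with `T_v := R_∞(a) ∘ R_f(b)`'s finite factor (the archimedean factor is the consumer's and commutes, ★ `integratedOperator_arch_comm_fin`).
* §1 `integratedOperator_apply_eq_smul_sum_of_forall_apply_eq` — the generic Hecke action on `K`-fixed vectors.
* §2 `coeFn_rightRegular_toLp_toQuotFun` (`R(k)[Φ] =ᵐ toQuotFun (rightTranslation 𝒢 k Φ)`), `coeFn_finset_sum_Lp` (a.e. representative of a finite sum in `Lp`),
  `sum_smul_rightRegular_toLp_toQuotFun_eq` (`Σ c_i • R(k_i)[Φ] = [Φ′]` from the function-level identity), and the HEAD **`integratedOperator_toLp_pseudoEisenstein_eq`**.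
HONEST LABEL: HC_CM is proved only modulo the 7 printed citations (2 remaining named inputs: hLiu418 = `stmt-HodgeConjecture-24832`, h413 = `stmt-HodgeConjecture-24833`) until rung 0
closes; this file is unconditional Haar ∕ `L²` bookkeeping, pays no letter (PB-3a's `hloc`, PB-2's Gram identity and the (L2)∕(L3) letters are NOT claimed), closes no socket;
REL ≠ ★ ≠ BUILT; count-neutral.

## References
* [BorelJacquet1979] A. Borel, H. Jacquet, *Automorphic forms and automorphic representations*, PSPM 33.1 (1979), §4.6 (`π(f)` on `K`-fixed vectors; `L²` classes of forms).
* [Cartier1979] P. Cartier, *Representations of p-adic groups: a survey*, PSPM 33.1 (1979), §IV.1 (the Hecke algebra of a compact open subgroup, `𝟙_{KaK}` as a sum of cosets).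
* [Folland1995] G. B. Folland, *A Course in Abstract Harmonic Analysis* (1995), §2.2 (left invariance of Haar measure on cosets), §3.2 (the integrated representation).
* [MoeglinWaldspurger1995] C. Mœglin, J.-L. Waldspurger, *Spectral decomposition and Eisenstein series* (1995), II.1.10 (Hecke operators on pseudo-Eisenstein series).
-/

set_option autoImplicit false
set_option linter.dupNamespace false  -- the mandated namespace `…HodgeConjecture.HodgeConjecture.R90.S8` (LEAD #1 L1) repeats the summit's segment

noncomputable section

open MeasureTheory Measure Set Filter Topology NumberField CompactlySupported
open scoped ENNReal Pointwise
open Literature.NumberTheory.Automorphic Literature.NumberTheory.Automorphic.UnitaryGroup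
open Literature.NumberTheory.Automorphic.UnitaryGroup.CotangentForms

namespace Summit.HodgeConjecture.HodgeConjecture.R90.S8

/-! ## §1 Generic: a Hecke operator acts on `K`-fixed vectors as a finite sum of translates -/

section Generic

variable {G : Type*} [Group G] [TopologicalSpace G] [MeasurableSpace G] [BorelSpace G]
  {E : Type*} [NormedAddCommGroup E] [InnerProductSpace ℂ E] [CompleteSpace E] {π : ContRepresentation ℂ G E}

/-- **`π(Σ_i c_i 𝟙_{a_i K}) v = η(K) · Σ_i c_i π(a_i) v` FOR A `K`-FIXED VECTOR `v`** (`K ≤ G` compact open, `η` left-invariant and finite on compacts, `b ∈ C_c(G)` with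
`b = Σ_{i∈s} c_i·𝟙_{a_i K}` pointwise): the integrated operator of a finite combination of left `K`-cosets acts on the `K`-fixed vectors as the finite sum of translates — on the coset
`y = a_i k`, `π(y) v = π(a_i) π(k) v = π(a_i) v`, and `η(a_i K) = η(K)`.  This is the action of the Hecke algebra `H(G, K)` on `V^K`. [cite: Cartier1979, §IV.1] [cite: BorelJacquet1979, §4.6]
[cite: Folland1995, §2.2 and §3.2] -/
theorem integratedOperator_apply_eq_smul_sum_of_forall_apply_eq (hu : π.IsUnitary) (hc : π.IsStronglyContinuous)
    (η : Measure G) [IsFiniteMeasureOnCompacts η] [η.IsMulLeftInvariant] [MeasurableMul G]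
    (K : Subgroup G) (hKo : IsOpen (K : Set G)) (hKc : IsCompact (K : Set G)) {v : E} (hv : ∀ k ∈ K, π k v = v)
    {ι : Type*} (s : Finset ι) (c : ι → ℂ) (a : ι → G) (b : C_c(G, ℂ))
    (hb : ∀ y, b y = ∑ i ∈ s, c i * (a i • (K : Set G)).indicator (fun _ => (1 : ℂ)) y) :
    π.integratedOperator hu hc η b v = (η K).toReal • ∑ i ∈ s, c i • π (a i) v := by
  classical
  -- the cosets as preimages under left multiplication: measurability and measure `η(K)`
  have hcoset : ∀ i, a i • (K : Set G) = (fun y => (a i)⁻¹ * y) ⁻¹' (K : Set G) := fun i => by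
    ext y
    rw [Set.mem_smul_set_iff_inv_smul_mem, smul_eq_mul, Set.mem_preimage]
  have hmeas : ∀ i, MeasurableSet (a i • (K : Set G)) := fun i => by
    rw [hcoset i]
    exact measurable_const_mul _ hKo.measurableSet
  have hvol : ∀ i, η (a i • (K : Set G)) = η K := fun i => by
    rw [hcoset i, measure_preimage_mul]
  have hKfin : η K < ∞ := hKc.measure_lt_top
  -- the integrand, coset by coset: `b(y) • π(y) v = Σ_i 𝟙_{a_i K}(y) • (c_i • π(a_i) v)`
  have hpt : ∀ y, b y • π y v = ∑ i ∈ s, (a i • (K : Set G)).indicator (fun _ => c i • π (a i) v) y := by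
    intro y
    rw [hb y, Finset.sum_smul]
    refine Finset.sum_congr rfl fun i _ => ?_
    by_cases hy : y ∈ a i • (K : Set G)
    · rw [Set.indicator_of_mem hy, Set.indicator_of_mem hy, mul_one]
      obtain ⟨k, hk, rfl⟩ := Set.mem_smul_set.1 hy
      rw [smul_eq_mul, map_mul, mul_apply_eq_comp, hv k hk]
    · rw [Set.indicator_of_notMem hy, Set.indicator_of_notMem hy, mul_zero, zero_smul]
  have hint : ∀ i ∈ s, Integrable (fun y => (a i • (K : Set G)).indicator (fun _ => c i • π (a i) v) y) η := fun i _ => by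
    refine (integrable_indicator_iff (hmeas i)).2 (integrableOn_const ?_)
    rw [hvol i]
    exact hKfin.ne
  rw [ContRepresentation.integratedOperator_apply]
  simp_rw [hpt]
  rw [integral_finsetSum s hint, Finset.smul_sum]
  refine Finset.sum_congr rfl fun i _ => ?_
  rw [integral_indicator_const _ (hmeas i), measureReal_def, hvol i]

end Generic

/-! ## §2 The automorphic reading: classes of forms, translates, and the Hecke port -/

section Automorphic

variable {F E : Type} [Field F] [NumberField F] [Field E] [NumberField E] [Algebra F E] {c : E ≃ₐ[F] E} {N : ℕ} {J : Matrix (Fin N) (Fin N) E}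
  {μ : Measure (adelicGroupData F E c N J).automorphicQuotient} [(adelicGroupData F E c N J).IsAutomorphicMeasure μ]

/-- **THE CLASS OF A TRANSLATE IS THE TRANSLATE OF THE CLASS (a.e.)**: for `Φ : G(𝔸) → ℂ` left-invariant under `A_G · G(K)` with square-integrable descent `[Φ] := toLp (toQuotFun 𝒢 Φ)`,
`R(k) [Φ] =ᵐ toQuotFun 𝒢 (rightTranslation 𝒢 k Φ)` — `(R(k)[Φ])([x]) = [Φ]([k⁻¹ x]) = Φ(x⁻¹ k)` (★ `rightRegular_apply_coeFn`, ★ `toQuotFun_mk`; the a.e. identity `[Φ] = toQuotFun Φ`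
transported along the measure-preserving translation `q ↦ k⁻¹ • q`). [cite: BorelJacquet1979, §4.6] -/
theorem coeFn_rightRegular_toLp_toQuotFun {Φ : (adelicGroupData F E c N J).Adelic → ℂ}
    (hleft : ∀ γ ∈ (adelicGroupData F E c N J).quotientSubgroup, ∀ x, Φ (γ * x) = Φ x) (k : (adelicGroupData F E c N J).Adelic)
    (hΦ : MemLp (toQuotFun (adelicGroupData F E c N J) Φ) 2 μ) :
    (((adelicGroupData F E c N J).rightRegular μ k (hΦ.toLp _) : (adelicGroupData F E c N J).L2 μ) : (adelicGroupData F E c N J).automorphicQuotient → ℂ) =ᵐ[μ]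
      toQuotFun (adelicGroupData F E c N J) (rightTranslation (adelicGroupData F E c N J) k Φ) := by
  have hleftk : ∀ γ ∈ (adelicGroupData F E c N J).quotientSubgroup, ∀ x, rightTranslation (adelicGroupData F E c N J) k Φ (γ * x) = rightTranslation (adelicGroupData F E c N J) k Φ x :=
    fun γ hγ x => by rw [rightTranslation_apply, rightTranslation_apply, mul_assoc, hleft γ hγ]
  -- `[Φ] = toQuotFun Φ` a.e., transported along `q ↦ k⁻¹ • q`
  have h1 := (adelicGroupData F E c N J).rightRegular_apply_coeFn (μ := μ) k (hΦ.toLp _)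
  have h2 : (fun q => ((hΦ.toLp _ : (adelicGroupData F E c N J).L2 μ) : (adelicGroupData F E c N J).automorphicQuotient → ℂ) (k⁻¹ • q)) =ᵐ[μ]
      fun q => toQuotFun (adelicGroupData F E c N J) Φ (k⁻¹ • q) :=
    (measurePreserving_smul k⁻¹ μ).quasiMeasurePreserving.ae_eq_comp hΦ.coeFn_toLp
  refine h1.trans (h2.trans (Filter.Eventually.of_forall fun q => ?_))
  obtain ⟨x, rfl⟩ := QuotientGroup.mk_surjective q
  show toQuotFun (adelicGroupData F E c N J) Φ ((adelicGroupData F E c N J).toAutomorphicQuotient (k⁻¹ * x)) =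
    toQuotFun (adelicGroupData F E c N J) (rightTranslation (adelicGroupData F E c N J) k Φ) ((adelicGroupData F E c N J).toAutomorphicQuotient x)
  rw [toQuotFun_mk hleft, toQuotFun_mk hleftk, rightTranslation_apply, mul_inv_rev, inv_inv]

/-- A finite sum in `L²` is represented a.e. by the sum of the representatives (`Lp.coeFn_add` by induction). [cite: Folland1995, §3.2] -/
theorem coeFn_finset_sum_Lp {X : Type*} {mX : MeasurableSpace X} {m : Measure X} {ι : Type*} (s : Finset ι) (f : ι → Lp ℂ 2 m) :
    (((∑ i ∈ s, f i : Lp ℂ 2 m)) : X → ℂ) =ᵐ[m] fun x => ∑ i ∈ s, (f i : X → ℂ) x := by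
  classical
  induction s using Finset.induction_on with
  | empty =>
    simp only [Finset.sum_empty]
    exact (Lp.coeFn_zero ℂ 2 m).trans (Filter.Eventually.of_forall fun _ => rfl)
  | insert i s hi ih =>
    rw [Finset.sum_insert hi]
    filter_upwards [Lp.coeFn_add (f i) (∑ j ∈ s, f j), ih] with x hx hx'
    rw [hx, Pi.add_apply, hx', Finset.sum_insert hi]

/-- **FINITE SUMS OF TRANSLATES OF THE CLASS = THE CLASS OF THE FINITE SUM OF TRANSLATES**: if `Σ_{i∈s} c_i • rightTranslation 𝒢 (k i) Φ = Φ′` as functions on `G(𝔸)` (the shape of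
★ PB-3a `sum_smul_rightTranslation_pseudoEisenstein_eq_of_localLetter`), then `Σ_{i∈s} c_i • R(k i) [Φ] = [Φ′]` in `L²([G])`. [cite: BorelJacquet1979, §4.6] [cite: MoeglinWaldspurger1995, II.1.10] -/
theorem sum_smul_rightRegular_toLp_toQuotFun_eq {Φ Φ' : (adelicGroupData F E c N J).Adelic → ℂ}
    (hleft : ∀ γ ∈ (adelicGroupData F E c N J).quotientSubgroup, ∀ x, Φ (γ * x) = Φ x)
    (hΦ : MemLp (toQuotFun (adelicGroupData F E c N J) Φ) 2 μ) (hΦ' : MemLp (toQuotFun (adelicGroupData F E c N J) Φ') 2 μ)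
    {ι : Type*} (s : Finset ι) (cf : ι → ℂ) (k : ι → (adelicGroupData F E c N J).Adelic)
    (hsum : ∑ i ∈ s, cf i • rightTranslation (adelicGroupData F E c N J) (k i) Φ = Φ') :
    ∑ i ∈ s, cf i • (adelicGroupData F E c N J).rightRegular μ (k i) (hΦ.toLp _) = hΦ'.toLp _ := by
  classical
  refine Lp.ext ?_
  have hterm : ∀ i ∈ s, ((cf i • (adelicGroupData F E c N J).rightRegular μ (k i) (hΦ.toLp _) : (adelicGroupData F E c N J).L2 μ) :
      (adelicGroupData F E c N J).automorphicQuotient → ℂ) =ᵐ[μ] fun q => cf i * toQuotFun (adelicGroupData F E c N J) (rightTranslation (adelicGroupData F E c N J) (k i) Φ) q :=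
    fun i _ => by
      filter_upwards [Lp.coeFn_smul (cf i) ((adelicGroupData F E c N J).rightRegular μ (k i) (hΦ.toLp _)), coeFn_rightRegular_toLp_toQuotFun hleft (k i) hΦ] with q hq hq'
      rw [hq, Pi.smul_apply, hq', smul_eq_mul]
  have hall : ∀ᵐ q ∂μ, ∀ i ∈ s, ((cf i • (adelicGroupData F E c N J).rightRegular μ (k i) (hΦ.toLp _) : (adelicGroupData F E c N J).L2 μ) :
      (adelicGroupData F E c N J).automorphicQuotient → ℂ) q = cf i * toQuotFun (adelicGroupData F E c N J) (rightTranslation (adelicGroupData F E c N J) (k i) Φ) q :=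
    (ae_ball_iff s.countable_toSet).2 hterm
  filter_upwards [coeFn_finset_sum_Lp s (fun i => cf i • (adelicGroupData F E c N J).rightRegular μ (k i) (hΦ.toLp _)), hall, hΦ'.coeFn_toLp] with q hq hq' hq''
  rw [hq, hq'', Finset.sum_congr rfl hq', ← hsum]
  simp only [toQuotFun, Finset.sum_apply, Pi.smul_apply, smul_eq_mul]

/-- **HEAD — THE `L²` ∕ `integratedOperator` PORT OF A HECKE OPERATOR (PB-3a-port).**  `𝒢 = adelicGroupData F E c N J`, `R` its right regular representation on `L²([G], μ)`,
`ι = finAdelicToAdelic`, `ν_f` a left-invariant measure finite on compacts on `G(𝔸_f)`, `K ≤ G(𝔸_f)` compact open, `b = Σ_{i∈s} c_i·𝟙_{a_i K} ∈ C_c(G(𝔸_f))` (a Hecke operator of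
level `K`); `Φ : G(𝔸) → ℂ` left-`A_G G(K)`-invariant, RIGHT-`ι(K)`-INVARIANT, with square-integrable descent, and `Φ′` with `Σ_{i∈s} c_i • rightTranslation 𝒢 (ι a_i) Φ = Φ′` (PB-3a's
output shape).  THEN `R_f(b) [Φ] = ν_f(K) · [Φ′]` — §1 at the `K`-fixed class `[Φ]` (★ `rightRegular_toLp_toQuotFun_eq_self_of_mul_right`) + `sum_smul_rightRegular_toLp_toQuotFun_eq`.
With `ν_f(K) = 1` (or the factor absorbed into the `c_i`) this is K2E1-p16's `hTx : T j (x i) = x (σ j i)` for the finite factor of `T j = R_∞(a) ∘ R_f(b)` at `x i := [θ_{f_i,ψ}]`.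
[cite: Cartier1979, §IV.1] [cite: BorelJacquet1979, §4.6] [cite: MoeglinWaldspurger1995, II.1.10] -/
theorem integratedOperator_toLp_pseudoEisenstein_eq
    [MeasurableSpace (finAdelic F E c N J)] [BorelSpace (finAdelic F E c N J)] [MeasurableMul (finAdelic F E c N J)]
    (νf : Measure (finAdelic F E c N J)) [IsFiniteMeasureOnCompacts νf] [νf.IsMulLeftInvariant]
    (K : Subgroup (finAdelic F E c N J)) (hKo : IsOpen (K : Set (finAdelic F E c N J))) (hKc : IsCompact (K : Set (finAdelic F E c N J)))
    {ι : Type*} (s : Finset ι) (cf : ι → ℂ) (a : ι → finAdelic F E c N J) (b : C_c(finAdelic F E c N J, ℂ))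
    (hb : ∀ y, b y = ∑ i ∈ s, cf i * (a i • (K : Set (finAdelic F E c N J))).indicator (fun _ => (1 : ℂ)) y)
    {Φ Φ' : (adelicGroupData F E c N J).Adelic → ℂ}
    (hleft : ∀ γ ∈ (adelicGroupData F E c N J).quotientSubgroup, ∀ x, Φ (γ * x) = Φ x)
    (hright : ∀ k ∈ K, ∀ x, Φ (x * finAdelicToAdelic F E c N J k) = Φ x)
    (hΦ : MemLp (toQuotFun (adelicGroupData F E c N J) Φ) 2 μ) (hΦ' : MemLp (toQuotFun (adelicGroupData F E c N J) Φ') 2 μ)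
    (hsum : ∑ i ∈ s, cf i • rightTranslation (adelicGroupData F E c N J) (finAdelicToAdelic F E c N J (a i)) Φ = Φ') :
    (((adelicGroupData F E c N J).rightRegular μ).restrict (finAdelicToAdelic F E c N J)).integratedOperator
        (((adelicGroupData F E c N J).isUnitary_rightRegular μ).restrict _)
        (((adelicGroupData F E c N J).isStronglyContinuous_rightRegular_holds μ).restrict _ (continuous_finAdelicToAdelic F E c N J)) νf b (hΦ.toLp _) =
      (νf K).toReal • hΦ'.toLp _ := by
  -- the class `[Φ]` is fixed by `R(ι k)`, `k ∈ K`
  have hv : ∀ k ∈ K, (((adelicGroupData F E c N J).rightRegular μ).restrict (finAdelicToAdelic F E c N J)) k (hΦ.toLp _) = hΦ.toLp _ := fun k hk =>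
    AdelicGroupData.rightRegular_toLp_toQuotFun_eq_self_of_mul_right hleft (hright k hk) hΦ
  rw [integratedOperator_apply_eq_smul_sum_of_forall_apply_eq _ _ νf K hKo hKc hv s cf a b hb]
  congr 1
  exact sum_smul_rightRegular_toLp_toQuotFun_eq hleft hΦ hΦ' s cf (fun i => finAdelicToAdelic F E c N J (a i)) hsum

end Automorphic

end Summit.HodgeConjecture.HodgeConjecture.R90.S8

end
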